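/-
Copyright: rh-split cell (screw, bridge) gen 19, 2026-08-28.  Splitting search over kernel-typed
RH-equivalences.  A splitting `A ∧ B ⟹ RH` is CONDITIONAL bookkeeping unless `A` and `B` are both
proved; nothing here bears on the truth of RH.
-/
import Summits.RiemannHypothesis.RiemannHypothesis.Theorems.Splittings.SlidingTheftGermB

/-!
# «SLIDING THEFT GERM» — part C of 3 (canonical module): bounded sliding hides no super-logarithmic tower

* §11 `BoundedSlidingTheft U η̄ A Z` — rh-idea-4's `SlidingTheft U Z` (PrimeWindowBlindness v3 §4; summand verbatim,
  `two_mul_sub_eq_pairTrace`) with zero-membership replaced by (H1) + ordinates `≥ 1`, slides bounded by `η̄`;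
  `SuperlogTower Z` — finitary genuine-tower clause (finite sets of atoms below `Y` of weight `> C log Y`, cofinally);
  `unresolved_weight_le_of_boundedSlidingTheft` — COUNT THEFT BOUND `Σ_{i∈s} m₁ ≤ (24/43)(601 A η̄ log Y + 20 σ*² A_Z)`
  for atoms unresolved at `Y ≥ max(4, 1/U)`; `not_boundedSlidingTheft_of_superlogTower` — the NO-GO ((c1) of
  theory-1's COUNT THEFT LAW): under `GermHyp`, a super-logarithmic tower admits no bounded sliding theft (`η̄ ≤ 1/2`).
* §12 NON-VACUITY: `countHyp_example` (`γ_k = k + 2`, `A = 3`); the EMPTY configuration satisfies `GermHyp`, admits the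
  trivial bounded sliding theft (`boundedSlidingTheft_emptyConfig` — the (c4) loophole certified: a blindness `∃ Z`
  needs a genuine-tower clause) and is not a `SuperlogTower`.
* ONE-SIDED, as kernelled (theory-1's wording note): the law says «below every height the stolen count is AT LEAST
  L·(unresolved tower weight) − slack»; the two-sided smoothed form `|R(Y) − 2N_Z(Y)| ≤ C[E_Z + Aη̄ log(Y+2)]` (factor 2
  exact for pure removal) is theory-1's `K7-COUNT-LAW-2SIDED.md` 48c9a1a6e3d8b86a, paper grade, not typed here.
* NOT HERE (next seat / other pens): K7′ «removal + sliding» (`RemovalSlideTheft`, rh-idea-4's zeta vocabulary) with the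
  necessary condition «removed count below `Y` = `2 N_Z(Y) + O(log Y)`» (theory-1 K7-AUDIT-v2 §1a, smoothed form); the
  bridge `SlidingTheft U Z ∧ |η| ≤ η̄ → BoundedSlidingTheft U η̄ A Z` needs the Riemann–von Mangoldt count as a
  Literature fact and lives with rh-idea-4's file.

HONEST LABEL: elementary real/complex analysis and finite-sum bookkeeping; an INSTRUMENT for another seat's
conjecture (rh-idea-4 K7 / theory-1 COUNT THEFT LAW); ζ-free, RH-free; toward RH: 0.
Nothing here bears on the truth of RH.
-/

set_option linter.dupNamespace false

namespace Summit.RiemannHypothesis.RiemannHypothesis.Theorems.Splittings.SlidingGerm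

open Summit.RiemannHypothesis.RiemannHypothesis.Theorems.Splittings.ScrewLatticeTower
open Summit.RiemannHypothesis.RiemannHypothesis.Theorems.Splittings.ScrewLatticeWolff (quadTerm modelPsi)

/-! ## 11. The no-go: bounded sliding hides no super-logarithmic tower -/

/-- **BOUNDED SLIDING THEFT with counting** — the pure-sliding identity of rh-idea-4's `SlidingTheft U Z`
(PrimeWindowBlindness v3 §4: the on-line pairs at ordinates `γ_k` are slid to `γ_k + η_k`, integers automatic,
and the signed compensation sums to `−Ψ_Z` on the window `|t| ≤ U`; summand verbatim), with the zero-membership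
clause REPLACED by the two things the no-go uses of it — ordinates `≥ 1` obeying the counting hypothesis (H1) with
constant `A` — and with the slides bounded by `η̄`.  (A `SlidingTheft U Z` witness with `|η_k| ≤ η̄` yields one:
forget membership and take (H1) from the Riemann–von Mangoldt formula.)  ζ-free, RH-free. -/
def BoundedSlidingTheft (U ηbar A : ℝ) (Z : Config) : Prop :=
  ∃ γ η : ℕ → ℝ, CountHyp A γ ∧ (∀ k, 1 ≤ γ k) ∧ (∀ k, |η k| ≤ ηbar) ∧
    ∀ t : ℝ, |t| ≤ U →
      HasSum (fun k ↦ 2 * ((1 - Real.cos ((γ k + η k) * t)) / (γ k + η k) ^ 2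
        - (1 - Real.cos (γ k * t)) / γ k ^ 2)) (-(Z.psi t))

/-- **SUPER-LOGARITHMIC TOWER** (first family, finitary): for every `C` and `Y₀` there is a height `Y ≥ Y₀` below
which some finite set of atoms (`‖κ₁ i‖ ≤ Y`) carries weight `> C·log Y`.  rh-idea-4's thin blind towers (count
`≍ T^e`) qualify; a finite or genuinely logarithmic configuration does not (the (c4) loophole of theory-1's audit:
the `∃ Z` of a blindness statement must carry a genuine-tower clause). -/
def SuperlogTower (Z : Config) : Prop :=
  ∀ C Y₀ : ℝ, ∃ Y : ℝ, Y₀ ≤ Y ∧ ∃ s : Finset Z.ι, (∀ i ∈ s, ‖Z.κ₁ i‖ ≤ Y) ∧ C * Real.log Y < ∑ i ∈ s, Z.m₁ i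

/-- The `SlidingTheft` summand is the difference of two pair traces. -/
theorem two_mul_sub_eq_pairTrace (γ η t : ℝ) :
    2 * ((1 - Real.cos ((γ + η) * t)) / (γ + η) ^ 2 - (1 - Real.cos (γ * t)) / γ ^ 2)
      = pairTrace (γ + η) t - pairTrace γ t := by
  unfold pairTrace; ring

/-- **COUNT THEFT BOUND (kernel form of theory-1's THEOREM).**  Under `GermHyp σ* Z` and a bounded sliding theft
with counting, every finite set of atoms unresolved at a height `Y ≥ max(4, 1/U)` has weight
`Σ_{i ∈ s} m₁ i ≤ (24/43)·(601·A·η̄·log Y + 20·σ*²·A_Z)` — below every height the tower's unresolved count is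
at most what bounded slides can feign, `O(η̄ log Y)`, plus the resolved-atom slack. -/
theorem unresolved_weight_le_of_boundedSlidingTheft {σs U ηbar A : ℝ} {Z : Config} (hZ : GermHyp σs Z)
    (hU : 0 < U) (hηbar : ηbar ≤ 1 / 2) (hT : BoundedSlidingTheft U ηbar A Z) {Y : ℝ} (hY4 : 4 ≤ Y)
    (hYU : 1 / U ≤ Y) (s : Finset Z.ι) (hs : ∀ i ∈ s, ‖Z.κ₁ i‖ ≤ Y) :
    ∑ i ∈ s, Z.m₁ i ≤ 24 / 43 * (601 * A * ηbar * Real.log Y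
      + 20 * σs ^ 2 * ∑' i, (Z.m₁ i / (Z.κ₁ i).im ^ 2 + Z.m₂ i / (Z.κ₂ i).im ^ 2)) := by
  obtain ⟨γ, η, hA, hγ, hη, hid⟩ := hT
  have hYpos : 0 < Y := by linarith
  set t := 1 / Y with ht
  have htpos : 0 < t := by positivity
  have ht4 : t ≤ 1 / 4 := one_div_le_one_div_of_le (by norm_num) hY4
  have ht1 : t ≤ 1 := by linarith
  have htU : |t| ≤ U := by rw [abs_of_pos htpos]; exact (one_div_le hYpos hU).mpr hYU
  have hYt : 1 / t = Y := one_div_one_div Y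
  -- (G2) summed at `t = 1/Y`
  have hsum : HasSum (fun k ↦ pairTrace (γ k + η k) t - pairTrace (γ k) t) (-(Z.psi t)) := by
    have h := hid t htU
    simp only [two_mul_sub_eq_pairTrace] at h
    exact h
  have hG2 := abs_slideSum_le_of_countHyp hA hγ hη hηbar htpos ht4 hsum
  rw [hYt, abs_neg] at hG2
  have hψ : Z.psi t ≤ 601 * A * ηbar * t ^ 2 * Real.log Y := le_trans (le_abs_self _) hG2
  -- (G1) at `t` for `s`
  have hs' : ∀ i ∈ s, ‖Z.κ₁ i‖ * t ≤ 1 := fun i hi ↦ by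
    rw [ht, ← div_eq_mul_one_div, div_le_one hYpos]; exact hs i hi
  have hG1 := Config.psi_ge_unresolved hZ htpos ht1 s hs'
  have h := hG1.trans hψ
  have ht2 : 0 < t ^ 2 := by positivity
  -- divide by `t²`
  by_contra hc
  push Not at hc
  have hc' : 0 < 43 / 24 * ∑ i ∈ s, Z.m₁ i
      - 20 * σs ^ 2 * ∑' i, (Z.m₁ i / (Z.κ₁ i).im ^ 2 + Z.m₂ i / (Z.κ₂ i).im ^ 2)
      - 601 * A * ηbar * Real.log Y := by linarith
  nlinarith [mul_pos ht2 hc']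

/-- **NO-GO: BOUNDED SLIDING HIDES NO SUPER-LOGARITHMIC TOWER** (corollary (c1) of theory-1's COUNT THEFT LAW
in kernel form; K7 «SLIDING ONLY» of rh-idea-4 is refuted at the `t → 0` germ for every super-logarithmic tower
and every slide bound `η̄ ≤ 1/2`, the zero-counting bound carried as hypothesis (H1)).  What survives is K7′
«removal + sliding» with the necessary condition «removed count below `Y` = `2·N_Z(Y) + O(log Y)`» (theory-1
K7-AUDIT-v2 §1a, smoothed form; not typed here). -/
theorem not_boundedSlidingTheft_of_superlogTower {σs U ηbar A : ℝ} {Z : Config} (hZ : GermHyp σs Z)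
    (hU : 0 < U) (hηbar : ηbar ≤ 1 / 2) (htower : SuperlogTower Z) : ¬ BoundedSlidingTheft U ηbar A Z := by
  intro hT
  set AZ := ∑' i, (Z.m₁ i / (Z.κ₁ i).im ^ 2 + Z.m₂ i / (Z.κ₂ i).im ^ 2) with hAZ
  set C := 24 / 43 * (601 * A * ηbar + 20 * σs ^ 2 * AZ) with hC
  obtain ⟨Y, hY, s, hs, hCs⟩ := htower C (max 4 (1 / U))
  have hY4 : 4 ≤ Y := le_trans (le_max_left _ _) hY
  have hYU : 1 / U ≤ Y := le_trans (le_max_right _ _) hY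
  have hb := unresolved_weight_le_of_boundedSlidingTheft hZ hU hηbar hT hY4 hYU s hs
  obtain ⟨γ, η, hA, -, hη, -⟩ := hT
  have hA0 : 0 ≤ A := hA.nonneg
  have hη0 : 0 ≤ ηbar := le_trans (abs_nonneg _) (hη 0)
  have hAZ0 : 0 ≤ AZ := by
    rw [hAZ]
    exact tsum_nonneg fun i ↦ by
      obtain ⟨h1, h2⟩ := hZ.m_nonneg i
      positivity
  have hlog : 1 ≤ Real.log Y := by
    rw [← Real.log_exp 1]
    refine Real.log_le_log (Real.exp_pos 1) (le_trans ?_ hY4)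
    have := Real.exp_one_lt_d9
    linarith
  have hmono : 24 / 43 * (601 * A * ηbar * Real.log Y + 20 * σs ^ 2 * AZ) ≤ C * Real.log Y := by
    rw [hC]
    have h1 : 20 * σs ^ 2 * AZ ≤ 20 * σs ^ 2 * AZ * Real.log Y := by
      have h0 : 0 ≤ 20 * σs ^ 2 * AZ := by positivity
      nlinarith
    nlinarith
  linarith


/-! ## 12. Non-vacuity: the hypotheses are satisfiable, and the genuine-tower clause is necessary -/

/-- The counting hypothesis is satisfiable: the ordinates `γ_k = k + 2` obey (H1) with `A = 3`. -/
theorem countHyp_example : CountHyp 3 (fun k : ℕ ↦ (k : ℝ) + 2) := by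
  intro X hX F hF
  have hsub : F ⊆ Finset.range ⌊X⌋₊ := by
    intro k hk
    have hk' := hF k hk
    have : k + 1 ≤ ⌊X⌋₊ := Nat.le_floor (by push_cast; linarith)
    exact Finset.mem_range.mpr (by omega)
  have hcard : (F.card : ℝ) ≤ X := by
    calc (F.card : ℝ) ≤ ((Finset.range ⌊X⌋₊).card : ℝ) := by exact_mod_cast Finset.card_le_card hsub
      _ = (⌊X⌋₊ : ℝ) := by rw [Finset.card_range]
      _ ≤ X := Nat.floor_le (by linarith)
  have hlog : 1 / 3 ≤ Real.log X := by
    have h2 := Real.log_two_gt_d9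
    have := Real.log_le_log (by norm_num) hX
    linarith
  nlinarith

/-- The EMPTY configuration (no off-line atoms). -/
def emptyConfig : Config := ⟨PEmpty, nofun, nofun, nofun, nofun⟩

/-- The empty configuration has `Ψ_Z ≡ 0`. -/
theorem emptyConfig_psi (t : ℝ) : emptyConfig.psi t = 0 := by
  simp [Config.psi, modelPsi, emptyConfig]

/-- The empty configuration satisfies the standing hypotheses (for any `σ* ≤ 1/2`). -/
theorem germHyp_emptyConfig {σs : ℝ} (hσs : σs ≤ 1 / 2) : GermHyp σs emptyConfig where
  m_nonneg := nofun
  re_mem := nofun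
  σs_le := hσs
  one_le_im := nofun
  summable := by
    have : (fun i : PEmpty ↦ emptyConfig.m₁ i / (emptyConfig.κ₁ i).im ^ 2
        + emptyConfig.m₂ i / (emptyConfig.κ₂ i).im ^ 2) = 0 := funext nofun
    exact this ▸ summable_zero

/-- **THE (c4) LOOPHOLE, CERTIFIED.**  `BoundedSlidingTheft` is satisfiable — trivially, by the empty configuration
with the null slide `η = 0` of the ordinates `γ_k = k + 2` (`A = 3`) — so the no-go has content, and a blindness
statement `∃ Z, clauses ∧ theft` carries information only together with a GENUINE-TOWER clause such as
`SuperlogTower Z` (which the empty configuration fails). -/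
theorem boundedSlidingTheft_emptyConfig (U : ℝ) {ηbar : ℝ} (hη : 0 ≤ ηbar) :
    BoundedSlidingTheft U ηbar 3 emptyConfig := by
  refine ⟨fun k ↦ (k : ℝ) + 2, fun _ ↦ 0, countHyp_example,
    fun k ↦ by have : (0 : ℝ) ≤ k := k.cast_nonneg; linarith,
    fun k ↦ by simpa using hη, fun t _ ↦ ?_⟩
  simp only [add_zero, sub_self, mul_zero, emptyConfig_psi, neg_zero]
  exact hasSum_zero

/-- The empty configuration is not a super-logarithmic tower. -/
theorem not_superlogTower_emptyConfig : ¬ SuperlogTower emptyConfig := by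
  intro h
  obtain ⟨Y, -, s, -, hC⟩ := h 0 0
  have : s = ∅ := Finset.eq_empty_of_forall_notMem nofun
  simp [this] at hC

end Summit.RiemannHypothesis.RiemannHypothesis.Theorems.Splittings.SlidingGerm
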